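import Summits.Parity.GeneralizedHardyLittlewood.Theorems.LiouvilleMADTypeIIToLevelEngine

/-!
# `TypeIIToLevel` (route `LiouvilleMAD`), part 2: the type-II piece and the master bound

Support file for the item stmt-Parity-14996
(`Summit.Parity.GeneralizedHardyLittlewood.Theses.LiouvilleMAD.TypeIIToLevel`).  Continues
`LiouvilleMADTypeIIToLevelEngine`: the type-II piece `F_U * G_U` of Vaughan's identity (dyadic blocks
`d ∈ (U2^j, U2^{j+1}]`, each cut into `K` short intervals by `abs_block_le`), and the master bound
`abs_sum_vonMangoldt_mul_le_param` for `|∑_{n ≤ x} Λ(n) lam(n)|` with free parameters `U, K, J, T`, from the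
inline Type-I budget `hI` and the inline rectangle Type-II hypothesis `hII` (see part 1).
Template: `Literature/NumberTheory/Sieve/FriedlanderIwaniecPrimesVaughanEngine.lean` (§26 of
Friedlander–Iwaniec 1998), transposed to `ℝ` and to budgets.
-/

noncomputable section

open Finset Real
open ArithmeticFunction
open scoped ArithmeticFunction.Moebius ArithmeticFunction.zeta ArithmeticFunction.sigma

namespace Summit.Parity.GeneralizedHardyLittlewood.Theorems.TypeIIToLevel

open Literature.NumberTheory.Sieve.Vaughan (cU gU fU arith_sub_apply vonMangoldt_eq_four_terms)
open Literature.NumberTheory.Sieve (moebiusTrunc vonMangoldtTrunc moebiusTrunc_apply vonMangoldtTrunc_apply)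

section TypeII

variable {lam : ℕ → ℝ} {U : ℕ} {W : ℝ}

/-- **The type-II piece of Vaughan's identity**: for `U ≥ 2`, `K ≥ 1`, `x ≤ U 2^J`, a uniform divisor
bound `τ(n) ≤ T` (`n ≤ x`, `T ≥ 1`), `|lam| ≤ 1` and the rectangle type-II hypothesis,
`|∑_{n ≤ x} (F_U * G_U)(n) lam(n)| ≤ J · [K (log x) T W x + (log x) T (x/K + x/U)]`
(dyadic blocks `d ∈ (U2^j, U2^{j+1}]`; blocks beyond `x/U` vanish because `G_U(m) = 0` for `m ≤ U`;
each remaining block by `abs_block_le`). [folklore; Friedlander–Iwaniec 1998 §26] -/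
theorem abs_sum_fU_gU_mul_le
    (hII : ∀ D₁ D₂ N : ℕ, U ≤ D₁ → D₁ ≤ D₂ → D₂ ≤ 2 * D₁ → U / 2 ≤ N →
      ∀ A B : ℝ, 0 ≤ A → 0 ≤ B → ∀ a b : ℕ → ℝ,
        (∀ d ∈ Ioc D₁ D₂, |a d| ≤ A) → (∀ m ∈ Ioc 0 N, |b m| ≤ B) →
        |∑ d ∈ Ioc D₁ D₂, a d * ∑ m ∈ Ioc 0 N, b m * lam (d * m)| ≤ A * B * W * D₁ * N)
    (hW : 0 ≤ W) (hlam : ∀ n, |lam n| ≤ 1) {x K J : ℕ} (hU : 2 ≤ U) (hK : 0 < K)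
    (hJ : x ≤ U * 2 ^ J) {T : ℝ} (hT1 : 1 ≤ T) (hT : ∀ n, n ≤ x → ((Nat.divisors n).card : ℝ) ≤ T) :
    |∑ n ∈ Ioc 0 x, (fU U * gU U) n * lam n| ≤
      J * (K * (Real.log x * T * W * x) + Real.log x * T * ((x : ℝ) / K + (x : ℝ) / U)) := by
  have hU0 : 0 < U := by omega
  have hT0 : 0 ≤ T := zero_le_one.trans hT1
  have hlogx : 0 ≤ Real.log x := Real.log_natCast_nonneg x
  -- the inner sums
  set I : ℕ → ℝ := fun d => ∑ m ∈ Ioc 0 (x / d), gU U m * lam (d * m) with hI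
  rw [Literature.NumberTheory.Sieve.sum_Ioc_mul_apply_mul_eq_sum_sum]
  -- Step 1: extend the range of `d` to `U 2^J ≥ x` (the new terms vanish: `x / d = 0`)
  have hext : ∑ d ∈ Ioc 0 x, fU U d * I d = ∑ d ∈ Ioc 0 (U * 2 ^ J), fU U d * I d := by
    refine sum_subset (Ioc_subset_Ioc_right hJ) fun d hd hdx => ?_
    rw [mem_Ioc] at hd; rw [mem_Ioc, not_and, not_le] at hdx
    have : x / d = 0 := Nat.div_eq_of_lt (hdx hd.1)
    simp [hI, this]
  -- Step 2: drop `d ≤ U` (where `F_U = 0`) and replace `F_U` by `Λ`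
  have hdrop : ∑ d ∈ Ioc 0 (U * 2 ^ J), fU U d * I d = ∑ d ∈ Ioc U (U * 2 ^ J), ArithmeticFunction.vonMangoldt d * I d := by
    rw [← sum_Ioc_consecutive _ (Nat.zero_le U) (Nat.le_mul_of_pos_right U (Nat.two_pow_pos J))]
    have h0 : ∑ d ∈ Ioc 0 U, fU U d * I d = 0 :=
      sum_eq_zero fun d hd => by rw [mem_Ioc] at hd; rw [Literature.NumberTheory.Sieve.Vaughan.fU_apply, if_pos hd.2]; simp
    rw [h0, zero_add]
    refine sum_congr rfl fun d hd => ?_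
    rw [mem_Ioc] at hd; rw [Literature.NumberTheory.Sieve.Vaughan.fU_apply, if_neg (by omega)]
  change |∑ d ∈ Ioc 0 x, fU U d * I d| ≤ _
  rw [hext, hdrop, Literature.NumberTheory.Sieve.Vaughan.sum_Ioc_mul_two_pow_eq_sum _ U J]
  -- Step 3: the blocks
  have hblock : ∀ j ∈ range J, |∑ d ∈ Ioc (U * 2 ^ j) (U * 2 ^ j + U * 2 ^ j), ArithmeticFunction.vonMangoldt d * I d| ≤
      K * (Real.log x * T * W * x) + Real.log x * T * ((x : ℝ) / K + (x : ℝ) / U) := by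
    intro j _
    set D := U * 2 ^ j with hD
    have hDU : U ≤ D := Nat.le_mul_of_pos_right U (Nat.two_pow_pos j)
    have hD0 : 0 < D := lt_of_lt_of_le hU0 hDU
    rw [← two_mul]
    by_cases hDx : D < x / U
    · -- a genuine block: `2D ≤ x`, `DU ≤ x`
      have hDUx : D * U ≤ x := (Nat.mul_le_mul_right U hDx.le).trans (Nat.div_mul_le_self x U)
      have h2D : 2 * D ≤ x := by
        have h1 : U * (D + 1) ≤ U * (x / U) := Nat.mul_le_mul_left U hDx
        have h2 : U * (x / U) ≤ x := Nat.mul_div_le x U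
        nlinarith
      have ha : ∀ d, d ≤ x → |(ArithmeticFunction.vonMangoldt d : ℝ)| ≤ Real.log x := by
        intro d hd
        rw [abs_of_nonneg vonMangoldt_nonneg]
        rcases Nat.eq_zero_or_pos d with rfl | hd0
        · simp [hlogx]
        · exact vonMangoldt_le_log.trans (Real.log_le_log (by exact_mod_cast hd0) (by exact_mod_cast hd))
      have hb : ∀ m, m ≤ x → |gU U m| ≤ T := by
        intro m hm
        refine (Literature.NumberTheory.Sieve.Vaughan.abs_gU_le U m).trans ?_
        rw [sigma_zero_apply]; exact hT m hm
      have hmain := abs_block_le hII hW hDU hD0 hDUx h2D hK hlogx hT0 (fun d => (ArithmeticFunction.vonMangoldt d : ℝ)) (fun m => gU U m)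
        ha hb hlam
      refine hmain.trans (add_le_add le_rfl ?_)
      refine mul_le_mul_of_nonneg_left ?_ (by positivity)
      have hK0 : (0 : ℝ) < K := by exact_mod_cast hK
      have hD0' : (0 : ℝ) < D := by exact_mod_cast hD0
      have hU0' : (0 : ℝ) < U := by exact_mod_cast hU0
      have hx0 : (0 : ℝ) ≤ x := Nat.cast_nonneg x
      have h1 : ((D / K + 1 : ℕ) : ℝ) ≤ (D : ℝ) / K + 1 := by
        have hdk : ((D / K : ℕ) : ℝ) ≤ (D : ℝ) / K := Nat.cast_div_le
        push_cast; linarith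
      have h2 : ((x / D : ℕ) : ℝ) ≤ (x : ℝ) / D := Nat.cast_div_le
      have h3 : (x : ℝ) / D ≤ (x : ℝ) / U := div_le_div_of_nonneg_left hx0 hU0' (by exact_mod_cast hDU)
      calc ((D / K + 1 : ℕ) : ℝ) * ((x / D : ℕ) : ℝ) ≤ ((D : ℝ) / K + 1) * ((x : ℝ) / D) :=
            mul_le_mul h1 h2 (Nat.cast_nonneg _) (by positivity)
        _ = (x : ℝ) / K + (x : ℝ) / D := by field_simp
        _ ≤ (x : ℝ) / K + (x : ℝ) / U := by linarith
    · -- beyond `x/U`: every inner sum vanishes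
      rw [not_lt] at hDx
      have hzero : ∑ d ∈ Ioc D (2 * D), (ArithmeticFunction.vonMangoldt d : ℝ) * I d = 0 := by
        refine sum_eq_zero fun d hd => ?_
        rw [mem_Ioc] at hd
        have hxd : x / d < U := by
          rw [Nat.div_lt_iff_lt_mul (by omega)]
          have h1 := Nat.lt_div_mul_add (a := x) hU0
          have h2 : U * (x / U + 1) ≤ U * d := Nat.mul_le_mul_left U (by omega)
          nlinarith
        have : I d = 0 := sum_eq_zero fun m hm => by
          rw [mem_Ioc] at hm
          rw [Literature.NumberTheory.Sieve.Vaughan.gU_eq_zero_of_le (by omega : m ≤ U)]; simp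
        rw [this, mul_zero]
      rw [hzero, abs_zero]; positivity
  calc |∑ i ∈ range J, ∑ d ∈ Ioc (U * 2 ^ i) (U * 2 ^ i + U * 2 ^ i), (ArithmeticFunction.vonMangoldt d : ℝ) * I d|
      ≤ ∑ i ∈ range J, (K * (Real.log x * T * W * x) + Real.log x * T * ((x : ℝ) / K + (x : ℝ) / U)) :=
        (abs_sum_le_sum_abs _ _).trans (sum_le_sum hblock)
    _ = J * (K * (Real.log x * T * W * x) + Real.log x * T * ((x : ℝ) / K + (x : ℝ) / U)) := by
        rw [sum_const, card_range, nsmul_eq_mul]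

end TypeII

/-! ### The master bound with free parameters -/

/-- **Vaughan's identity against `lam`, all four pieces** (parameters `U ≥ 2`, `K ≥ 1`, `J` with
`x ≤ U 2^J`, a uniform divisor bound `T ≥ 1` on `[1, x]`; `|lam| ≤ 1`; Type-I budget `F ≥ 0` for `d ≤ U²`;
rectangle Type-II hypothesis with constant `W ≥ 0`):
`|∑_{n ≤ x} Λ(n) lam(n)| ≤ U log U + 2 log x ∑_{d ≤ U} F d + 2 log U ∑_{d ≤ U²} F d
  + J [K (log x) T W x + (log x) T (x/K + x/U)]`. [folklore; Vaughan 1980, Friedlander–Iwaniec 1998 §26] -/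
theorem abs_sum_vonMangoldt_mul_le_param {lam : ℕ → ℝ} {x U : ℕ} {F : ℕ → ℝ} {W : ℝ}
    (hI : ∀ d t : ℕ, 1 ≤ d → d ≤ U * U → t ≤ x / d → |∑ m ∈ Ioc 0 t, lam (d * m)| ≤ F d)
    (hF : ∀ d, 0 ≤ F d)
    (hII : ∀ D₁ D₂ N : ℕ, U ≤ D₁ → D₁ ≤ D₂ → D₂ ≤ 2 * D₁ → U / 2 ≤ N →
      ∀ A B : ℝ, 0 ≤ A → 0 ≤ B → ∀ a b : ℕ → ℝ,
        (∀ d ∈ Ioc D₁ D₂, |a d| ≤ A) → (∀ m ∈ Ioc 0 N, |b m| ≤ B) →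
        |∑ d ∈ Ioc D₁ D₂, a d * ∑ m ∈ Ioc 0 N, b m * lam (d * m)| ≤ A * B * W * D₁ * N)
    (hW : 0 ≤ W) (hlam : ∀ n, |lam n| ≤ 1) {K J : ℕ} (hU : 2 ≤ U) (hK : 0 < K)
    (hJ : x ≤ U * 2 ^ J) {T : ℝ} (hT1 : 1 ≤ T) (hT : ∀ n, n ≤ x → ((Nat.divisors n).card : ℝ) ≤ T) :
    |∑ n ∈ Ioc 0 x, ArithmeticFunction.vonMangoldt n * lam n| ≤
      U * Real.log U + 2 * Real.log x * ∑ d ∈ Ioc 0 U, F d + 2 * Real.log U * ∑ d ∈ Ioc 0 (U * U), F d +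
        J * (K * (Real.log x * T * W * x) + Real.log x * T * ((x : ℝ) / K + (x : ℝ) / U)) := by
  -- Vaughan's identity pointwise
  have hΛ : ∀ n, (ArithmeticFunction.vonMangoldt n : ℝ) = vonMangoldtTrunc U n +
      ((moebiusTrunc U : ArithmeticFunction ℝ) * ArithmeticFunction.log) n -
        (cU U * (ζ : ArithmeticFunction ℝ)) n + (fU U * gU U) n := by
    intro n
    have h := congrArg (fun G : ArithmeticFunction ℝ => G n) (vonMangoldt_eq_four_terms U)
    simp only [ArithmeticFunction.add_apply, arith_sub_apply] at h
    exact h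
  simp_rw [hΛ, add_mul, sub_mul, add_mul, sum_add_distrib, sum_sub_distrib, sum_add_distrib]
  have h0 := abs_sum_vonMangoldtTrunc_mul_le hlam x U
  have h1 := abs_sum_moebiusTrunc_log_mul_le hI hF
  have h2 := abs_sum_cU_zeta_mul_le hI hF
  have h3 := abs_sum_fU_gU_mul_le hII hW hlam hU hK hJ hT1 hT
  calc _ ≤ |∑ n ∈ Ioc 0 x, vonMangoldtTrunc U n * lam n +
          ∑ n ∈ Ioc 0 x, ((moebiusTrunc U : ArithmeticFunction ℝ) * ArithmeticFunction.log) n * lam n -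
          ∑ n ∈ Ioc 0 x, (cU U * (ζ : ArithmeticFunction ℝ)) n * lam n| +
        |∑ n ∈ Ioc 0 x, (fU U * gU U) n * lam n| := abs_add_le _ _
    _ ≤ (|∑ n ∈ Ioc 0 x, vonMangoldtTrunc U n * lam n| +
          |∑ n ∈ Ioc 0 x, ((moebiusTrunc U : ArithmeticFunction ℝ) * ArithmeticFunction.log) n * lam n| +
          |∑ n ∈ Ioc 0 x, (cU U * (ζ : ArithmeticFunction ℝ)) n * lam n|) +
        |∑ n ∈ Ioc 0 x, (fU U * gU U) n * lam n| := by
        gcongr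
        exact (abs_sub _ _).trans (add_le_add (abs_add_le _ _) le_rfl)
    _ ≤ _ := by linarith

end Summit.Parity.GeneralizedHardyLittlewood.Theorems.TypeIIToLevel

end
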